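import Summits.ValiantsHypothesis.ValiantsHypothesis.Theses.DetQP
import Summits.ValiantsHypothesis.ValiantsHypothesis.Theses.GCTMult

/-!
# ValiantsHypothesis / DetQP and GCTMult — `Assembly` (item `stmt-ValiantsHypothesis-0316`)

Item `stmt-ValiantsHypothesis-0316` (assembly, rank 1; the SAME statement is the `Assembly` decl of
route `DetQP` and of route `GCTMult`): with the three literature results inlined as hypotheses —
(i) every `VP` family has quasi-polynomially bounded determinantal complexity
(Valiant–Skyum–Berkowitz–Rackoff 1983 + Valiant 1979; Bürgisser–Clausen–Shokrollahi 1997,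
Cor. (21.40); in the tree `isQPBounded_determinantalComplexity_of_isVPFamily_holds`), (ii) the
`ofFintype` renaming bridge `perFamily ℂ ∈ VP ℂ ↔ IsVPFamily (fun n => perPoly (Fin n) ℂ)`
(Bürgisser 2000, Rem. 2.2; tree `mem_VP_ofFintype_iff_holds`), (iii) `per ∈ VNP` (Valiant 1979;
tree `perFamily_mem_VNP_holds`) — the DetQP thesis `¬ IsQPBounded (n ↦ dc(per_n))` implies
`ValiantsHypothesis` (`VP_ℂ ≠ VNP_ℂ`).

Pure bookkeeping (four lines): if `VP ℂ = VNP ℂ` then `perFamily ℂ ∈ VP ℂ` by (iii), so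
`(per_n)_n` is a `VP` family by (ii), so `dc(per_n)` is quasi-polynomially bounded by (i),
contradicting the thesis. The unconditional version with (i)–(iii) discharged is the tree's
`Summit.ValiantsHypothesis.Theorems.dcqpToVH_proof` (item `stmt-ValiantsHypothesis-3786`) and
`Summit.PneNP.GCT.valiantsHypothesis_of_not_isQPBounded_dc` (`SufficesForValiant.lean`); this file
only closes the assembly item as FILED (hypotheses inlined). Honest framing: an implication between
an open thesis and the summit; nothing here is progress on `VP ≠ VNP`.
-/

namespace Summit.ValiantsHypothesis.ValiantsHypothesis.Theorems

set_option linter.dupNamespace false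

open Literature.Computability.AlgebraicComplexity

/-- Settles `stmt-ValiantsHypothesis-0316` under route `DetQP`'s name (`DetQP.Assembly`):
(`VP` families have qp-bounded `dc`) → `¬ IsQPBounded (n ↦ dc(per_n))` →
(`perFamily ℂ ∈ VP ℂ ↔ IsVPFamily per`) → `perFamily ℂ ∈ VNP ℂ` → `VP_ℂ ≠ VNP_ℂ`.
If `VP ℂ = VNP ℂ`, the permanent family lies in `VP`, hence is a `VP` family, hence has
quasi-polynomially bounded `dc` — contradiction. [cite: BurgisserClausenShokrollahi1997, Cor. (21.40)] -/
theorem detqp_assembly_proof :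
    Summit.ValiantsHypothesis.ValiantsHypothesis.Theses.DetQP.Assembly := by
  unfold Summit.ValiantsHypothesis.ValiantsHypothesis.Theses.DetQP.Assembly
  intro hqp hnqp hbridge hVNP hEq
  have hVP : perFamily ℂ ∈ VP ℂ := by
    rw [hEq]
    exact hVNP
  exact hnqp (hqp (fun n => perPoly (Fin n) ℂ) (hbridge.1 hVP))

/-- Settles `stmt-ValiantsHypothesis-0316` under route `GCTMult`'s name (`GCTMult.Assembly`,
literally the same term as `DetQP.Assembly`). [cite: BurgisserClausenShokrollahi1997, Cor. (21.40)] -/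
theorem gctMult_assembly_proof :
    Summit.ValiantsHypothesis.ValiantsHypothesis.Theses.GCTMult.Assembly :=
  detqp_assembly_proof

end Summit.ValiantsHypothesis.ValiantsHypothesis.Theorems
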